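import Literature.NumberTheory.Transcendental.PhilipponCriterionRank
import Literature.NumberTheory.Transcendental.PhilipponCriterionComponent
import Literature.NumberTheory.Transcendental.NesterenkoEliminationFacts2
import HarnessLib

/-!
# Philippon's criterion over Nesterenko's toolkit, VII: cutting a prime by a hypersurface — proofs only

`Literature/NumberTheory/Transcendental/PhilipponCriterionCut.lean` — proofs only (no new
definitions, nothing asserted). One step of Philippon's induction (Publ. Math. IHÉS 64 (1986), §3,
Lemme 2.14, pp. 43–45) replaces the prime `𝔓 = 𝔓_{N,r}` by a minimal prime of `(𝔓, Q)` for a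
generator `Q` of `I_M` not in `𝔓`: "il existe un idéal premier minimal de codimension `n − r + 2`
associé à `ρ(𝔓_{N,r}[d_N])` … que nous posons dorénavant égal à `𝔓_{N,r−1}`", with degree and
height controlled by Bézout (the conditions `(i)_{N,r−1}`) and containing `𝔓_{N,r}` (`(0)_{N,r−1}`).
On Nesterenko's side the intersection is LNM 1752 Ch. 3 Prop. 4.11 / Cor. 4.12
(`NesterenkoPhilippon2001_ch3_prop_4_11`, `…_cor_4_12`), which return SOME homogeneous unmixed `J` of
rank `r − 1` with `V(J) = V((𝔓, E))`. This file proves what every prime component `𝔮` of any such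
`J` (with `V(𝔮) ≠ ∅`) inherits, independently of which of the two statements produced `J` — in
particular the degree and height bounds are always those of the `η`-FREE Prop. 4.11
(`cut_component_facts`):

* `𝔓 ⊆ 𝔮` and `E ∈ 𝔮` (projective Nullstellensatz, `PhilipponCriterionRank.lean`);
* `deg 𝔮 ≤ deg 𝔓 · deg E` and `h(𝔮) ≤ h(𝔓) deg E + h(E) deg 𝔓 + (m(r+1) + m²) deg 𝔓 deg E`: indeed
  `V(𝔮) ⊆ V(J) = V((𝔓, E)) = V(J') = ⋃ V(√Q')` for Prop. 4.11's `J'`, so some `√Q' ⊆ 𝔮`, and primes of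
  the same rank `r − 1` in inclusion are equal; then Prop. 4.7 1), 2) for `J'`
  (`PhilipponCriterionComponent.lean`).

Auxiliary: `projZeros` of `𝔓 ⊔ (E)` and of `(E)` (homogeneous ideals contain the homogeneous
components of their elements: Mathlib's `MvPolynomial.homogeneousComponent_mem_of_mem`).

## References

* [Philippon1986Criteres] P. Philippon, Publ. Math. IHÉS 64 (1986), §3, Lemme 2.14 (pp. 43–45),
  Prop. 2.6 (p. 34).
* [NesterenkoPhilippon2001] LNM 1752 (2001), Ch. 3 Prop. 4.7, Prop. 4.11, Cor. 4.12 (pp. 39–41).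
-/

noncomputable section

open MvPolynomial
open Literature.NumberTheory.Transcendental.Nesterenko

attribute [local instance] MvPolynomial.gradedAlgebra

namespace Literature.NumberTheory.Transcendental

namespace PhilipponMain

variable {m : ℕ}

/-! ### Homogeneous ideals and zero sets -/

/-- `V(I ⊔ J) = V(I) ∩ V(J)`. [folklore] -/
theorem projZeros_sup (I J : Ideal (Rx m)) : projZeros (I ⊔ J) = projZeros I ∩ projZeros J := by
  ext β
  constructor
  · intro h
    exact ⟨⟨h.1, fun P hP => h.2 P (Ideal.mem_sup_left hP)⟩,
      ⟨h.1, fun P hP => h.2 P (Ideal.mem_sup_right hP)⟩⟩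
  · rintro ⟨hI, hJ⟩
    refine ⟨hI.1, fun P hP => ?_⟩
    obtain ⟨p, hp, j, hj, rfl⟩ := Submodule.mem_sup.mp hP
    rw [map_add, hI.2 p hp, hJ.2 j hj, add_zero]

/-- `V((E)) = {β̄ ≠ 0 : E(β̄) = 0}`. [folklore] -/
theorem projZeros_span_singleton (E : Rx m) :
    projZeros (Ideal.span {E}) = {β | β ≠ 0 ∧ aeval β E = 0} := by
  ext β
  simp only [projZeros, Set.mem_setOf_eq]
  constructor
  · rintro ⟨h0, h⟩
    exact ⟨h0, h E (Ideal.subset_span rfl)⟩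
  · rintro ⟨h0, h⟩
    refine ⟨h0, fun P hP => ?_⟩
    obtain ⟨c, rfl⟩ := Ideal.mem_span_singleton'.mp hP
    rw [map_mul, h, mul_zero]

/-- `V` is antitone: `I ≤ J ⇒ V(J) ⊆ V(I)`. [folklore] -/
theorem projZeros_antitone {I J : Ideal (Rx m)} (h : I ≤ J) : projZeros J ⊆ projZeros I :=
  fun _ hβ => ⟨hβ.1, fun P hP => hβ.2 P (h hP)⟩

/-- A component `Q` of a decomposition `t` of `I` contains `I`, so `V(√Q) ⊆ V(I)`. [folklore] -/
theorem projZeros_radical_subset_of_mem {I : Ideal (Rx m)} {t : Finset (Ideal (Rx m))}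
    (ht : Submodule.IsMinimalPrimaryDecomposition I t) {Q : Ideal (Rx m)} (hQ : Q ∈ t) :
    projZeros Q.radical ⊆ projZeros I := by
  refine projZeros_antitone (le_trans ?_ Ideal.le_radical)
  rw [← ht.inf_eq]
  exact Finset.inf_le hQ

/-- A homogeneous polynomial of positive degree vanishes at the origin. [folklore] -/
theorem aeval_zero_eq_zero_of_isHomogeneous {E : Rx m} {d : ℕ} (hE : E.IsHomogeneous d) (hd : 1 ≤ d) :
    aeval (0 : Fin (m + 1) → ℂ) E = 0 := by
  rw [MvPolynomial.aeval_zero, constantCoeff_eq]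
  have : coeff 0 E = 0 := hE.coeff_eq_zero (by
    rw [map_zero]
    omega)
  change algebraMap ℚ ℂ (coeff 0 E) = 0
  rw [this, map_zero]

/-! ### What a prime component of a cut inherits -/

/-- **The cut.** Let `𝔓 ⊂ ℚ[x₀, …, x_m]` be a homogeneous prime of rank `r` (`2 ≤ r ≤ m`), `E ∉ 𝔓`
homogeneous of degree `d`, `J` ANY homogeneous unmixed ideal of rank `r − 1` with `V(J) = V((𝔓, E))`
(as returned by Prop. 4.11 or Cor. 4.12), `t` a reduced primary decomposition of `J` and `Q ∈ t` with
`V(√Q) ≠ ∅`. Then `𝔓 ⊆ √Q`, `E ∈ √Q`, `deg √Q ≤ deg 𝔓 · d` and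
`h(√Q) ≤ h(𝔓) d + h(E) deg 𝔓 + (m(r+1) + m²) deg 𝔓 d` (the bounds of the `η`-free Prop. 4.11,
transported to `√Q` through `V(√Q) ⊆ ⋃ V(√Q')` over Prop. 4.11's own decomposition, equality of
primes of equal rank in inclusion, and Prop. 4.7 1), 2)).
[cite: Philippon1986Criteres, §3 Lemme 2.14 (pp. 43–45)]
[cite: NesterenkoPhilippon2001, Ch. 3 Prop. 4.11 (pp. 40–41)] -/
theorem cut_component_facts (h47 : NesterenkoPhilippon2001_ch3_prop_4_7)
    (h411 : NesterenkoPhilippon2001_ch3_prop_4_11) {r : ℕ} (hr2 : 2 ≤ r) (hrm : r ≤ m)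
    {𝔓 : Ideal (Rx m)} (h𝔓 : 𝔓.IsPrime)
    (h𝔓hom : 𝔓.IsHomogeneous (homogeneousSubmodule (Fin (m + 1)) ℚ)) (h𝔓unm : IsUnmixedOfRank 𝔓 r)
    {E : Rx m} {d : ℕ} (hE : E.IsHomogeneous d) (hE𝔓 : E ∉ 𝔓)
    {J : Ideal (Rx m)} (hJhom : J.IsHomogeneous (homogeneousSubmodule (Fin (m + 1)) ℚ))
    (hJunm : IsUnmixedOfRank J (r - 1)) (hJV : projZeros J = projZeros (𝔓 ⊔ Ideal.span {E}))
    {t : Finset (Ideal (Rx m))} (ht : Submodule.IsMinimalPrimaryDecomposition J t)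
    {Q : Ideal (Rx m)} (hQ : Q ∈ t) (hne : (projZeros Q.radical).Nonempty) :
    𝔓 ≤ Q.radical ∧ E ∈ Q.radical ∧
      ideg Q.radical (r - 1) ≤ ideg 𝔓 r * d ∧
      iheight Q.radical (r - 1) ≤ iheight 𝔓 r * d + height E * ideg 𝔓 r +
        ((m : ℝ) * (r + 1) + (m : ℝ) ^ 2) * ideg 𝔓 r * d := by
  classical
  obtain ⟨hqprime, hqhom, hqunm, -, -⟩ :=
    Literature.Barriers.Schanuel.radical_component_facts hJhom hJunm ht hQ
  have h𝔓c : ∀ g ∈ 𝔓, ∀ k : ℕ, homogeneousComponent k g ∈ 𝔓 :=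
    fun g hg k => homogeneousComponent_mem_of_mem h𝔓hom hg k
  -- `V(√Q) ⊆ V(𝔓) ∩ V(E)`
  have hV : projZeros Q.radical ⊆ projZeros 𝔓 ∩ projZeros (Ideal.span {E}) := by
    rw [← projZeros_sup, ← hJV]
    exact projZeros_radical_subset_of_mem ht hQ
  -- `𝔓 ⊆ √Q`
  have h𝔓le : 𝔓 ≤ Q.radical :=
    le_of_projZeros_subset hqprime h𝔓c h𝔓.ne_top (hV.trans Set.inter_subset_left)
  -- `d ≥ 1`: otherwise `E` is a non-zero constant and `V(E) = ∅`
  have hE0 : E ≠ 0 := fun h => hE𝔓 (h ▸ 𝔓.zero_mem)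
  have hd : 1 ≤ d := by
    by_contra hd0
    have hd0' : d = 0 := by omega
    subst hd0'
    obtain ⟨β, hβ⟩ := hne
    have hβE := (hV hβ).2
    rw [projZeros_span_singleton] at hβE
    -- `E = C c`, `c ≠ 0`, does not vanish anywhere
    have h00 : E.totalDegree = 0 := le_antisymm hE.totalDegree_le (Nat.zero_le _)
    have hEC : E = C (coeff 0 E) := totalDegree_eq_zero_iff_eq_C.mp h00
    have hc0 : coeff 0 E ≠ 0 := fun hc => hE0 (by rw [hEC, hc, C_0])
    apply hc0
    have h2 := hβE.2
    rw [hEC, aeval_C] at h2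
    exact (map_eq_zero_iff _ (algebraMap ℚ ℂ).injective).mp h2
  -- `E ∈ √Q`
  have hEmem : E ∈ Q.radical :=
    mem_of_forall_mem_projZeros_aeval_eq_zero hqprime (aeval_zero_eq_zero_of_isHomogeneous hE hd)
      fun β hβ => by
        have h := (hV hβ).2
        rw [projZeros_span_singleton] at h
        exact h.2
  -- Prop. 4.11's own `J'` and its decomposition
  obtain ⟨J', hJ'hom, hJ'unm, hJ'V, hdeg', hh', -⟩ :=
    (h411 m r 𝔓 E d (by omega) hrm h𝔓 h𝔓hom h𝔓unm hE hd hE𝔓).1 hr2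
  obtain ⟨t', ht'⟩ : ∃ t' : Finset (Ideal (Rx m)), Submodule.IsMinimalPrimaryDecomposition J' t' :=
    Submodule.IsLasker.exists_isMinimalPrimaryDecomposition (Submodule.isLasker (Rx m) (Rx m)) J'
  have hQ'facts := fun (Q' : Ideal (Rx m)) (hQ' : Q' ∈ t') =>
    Literature.Barriers.Schanuel.radical_component_facts hJ'hom hJ'unm ht' hQ'
  -- `V(√Q) ⊆ V(J') = ⋃ V(√Q')`, so some `√Q' ⊆ √Q`, hence `√Q' = √Q`
  have hVJ' : projZeros Q.radical ⊆ ⋃ Q' ∈ t', projZeros Q'.radical := by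
    rw [← projZeros_eq_biUnion_radical ht'.inf_eq, hJ'V, ← hJV]
    exact projZeros_radical_subset_of_mem ht hQ
  obtain ⟨Q', hQ't', hle⟩ := exists_le_of_projZeros_subset_biUnion (s := t')
    (𝔭 := fun Q' : Ideal (Rx m) => Q'.radical) hqprime
    (fun Q' hQ' => (fun g hg k => homogeneousComponent_mem_of_mem (hQ'facts Q' hQ').2.1 hg k))
    (fun Q' hQ' => (hQ'facts Q' hQ').1.ne_top) hne hVJ'
  have heq : Q'.radical = Q.radical :=
    eq_of_le_of_isUnmixedOfRank (hQ'facts Q' hQ't').1 hqprime hle (hQ'facts Q' hQ't').2.2.1 hqunm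
  -- Prop. 4.7 1), 2) for `J'`
  obtain ⟨β, hβ⟩ := hne
  obtain ⟨hsum1, hsum2, -⟩ := h47 m (r - 1) J' (by omega) (by omega) hJ'hom hJ'unm t' ht' β hβ.1
  have hk1 : ∀ Q'' ∈ t', 1 ≤ primaryExponent Q'' := fun Q'' hQ'' => (hQ'facts Q'' hQ'').2.2.2.2
  have hdegQ : ideg Q.radical (r - 1) ≤ ideg J' (r - 1) := by
    rw [← heq]; exact ideg_radical_le hsum1 hk1 hQ't'
  have hhQ : iheight Q.radical (r - 1) ≤ iheight J' (r - 1) + (m : ℝ) ^ 2 * ideg J' (r - 1) := by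
    rw [← heq]; exact iheight_radical_le hsum2 hk1 hQ't'
  refine ⟨h𝔓le, hEmem, hdegQ.trans hdeg', hhQ.trans ?_⟩
  have hdeg'R : (ideg J' (r - 1) : ℝ) ≤ (ideg 𝔓 r : ℝ) * d := by exact_mod_cast hdeg'
  have hm0 : (0 : ℝ) ≤ (m : ℝ) ^ 2 := by positivity
  calc iheight J' (r - 1) + (m : ℝ) ^ 2 * ideg J' (r - 1)
      ≤ (iheight 𝔓 r * d + height E * ideg 𝔓 r + (m : ℝ) * (r + 1) * ideg 𝔓 r * d) +
          (m : ℝ) ^ 2 * ((ideg 𝔓 r : ℝ) * d) := add_le_add hh' (mul_le_mul_of_nonneg_left hdeg'R hm0)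
    _ = iheight 𝔓 r * d + height E * ideg 𝔓 r + ((m : ℝ) * (r + 1) + (m : ℝ) ^ 2) * ideg 𝔓 r * d := by
        ring

end PhilipponMain

end Literature.NumberTheory.Transcendental

end
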